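import Literature.RepresentationTheory.HeisenbergGroup.SchrodingerPiOperators
import Literature.RepresentationTheory.HeisenbergGroup.SchrodingerCommutantPi
import HarnessLib

/-!
# Big-cell words in the Schrödinger model: the scalar of a family `ω(z₀ k) = c(k) · r(n(γ_k)) r(m(B_k)) r(w) r(n(δ_k))`
# is constant up to `|det B_k|^{1/2}` (test-vector evaluation at `0`)

Topic `RepresentationTheory/HeisenbergGroup`; namespace `Literature.RepresentationTheory.HeisenbergGroup` (sequel of
`SchrodingerPiOperators.lean`).  KERNEL mathematics only: theorems, no definition, no named fact, no `sorry`.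

Setting: `F` a non-archimedean local field with `2` invertible, `ψ` continuous non-trivial of conductor exponent `m`, `μ`
an additive Haar measure on `F`, `𝒮(F^ι)` with the standard operators `r(n(c)) = unipOpPi`, `r(m(a)) = leviOpPi` (carrying
`|det a|^{-1/2}`), `r(w) = fourierOpPi` of [Rangarao1993, Lemma 3.2] / [Weil1964, n° 13]; `G` ANY group, `ω` ANY
representation of `G` on `𝒮(F^ι)`, `K ≤ G`, `z₀ ∈ G`, and a FAMILY OF BIG-CELL WORDS along the coset `z₀ K`:

  `ω(z₀ k) f = c(k) · r(n(γ_k)) r(m(B_k)) r(w) r(n(δ_k)) f`   (`k ∈ K`).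

If the test vector `𝟙_{(𝔭ⁿ)^ι}` is `ω(K)`-fixed and the phases `½⟨x, δ_k x⟩` lie in the conductor `𝔭^m` on the box
`(𝔭ⁿ)^ι` (deep box), then EVALUATING AT `0`:
`(ω(z₀ k) 𝟙)(0) = c(k) |det B_k|^{-1/2} μ^ι((𝔭ⁿ)^ι)` while `ω(z₀ k) 𝟙 = ω(z₀) 𝟙` — so

* `wordScalar_mul_inv_modSqrt_eq` — `c(k) |det B_k|^{-1/2} = c(1) |det B_1|^{-1/2}` for all `k ∈ K`;
* `exists_const_word` — the family has the shape `ω(z₀ k) f = (c₀ · |det B_k|^{1/2}) · word_k f` with ONE constant `c₀`;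
  `exists_ne_zero_const_word` — and `c₀ ≠ 0` as soon as `c(1) ≠ 0` (appended);
* §2 `halfForm_smul_id_mem_primePowBall` — the phase hypothesis `hδ` for scalar unipotents `δ = g · 1` on deep boxes
  (`g ∈ 𝔭^r`, `x ∈ (𝔭ⁿ)^ι`, `m ≤ r + 2n - v₂` ⇒ `½⟨x, g x⟩ ∈ 𝔭^m`), with `invOf_two_mem_primePowBall`.

This is the «section-scalar constancy» step (λ-constancy, M-c) of the finite-level character computation for the rank-one
oscillator representation (cell hodgecm-mathlib, c3 wall, B-p04's carve 2026-08-28T05:45:53Z hypothesis (W1), H1 of B-p17):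
there `G = U(J₁)(F_v)`, `ω = ω_{s₁}`, the word is Weil's `r(ι(z₀ k))` on the big cell and `c(k)` the section scalar.
HC_CM is not advanced by this file alone.

## References
* [Rangarao1993] R. Ranga Rao, Pacific J. Math. 157 (1993), Lemma 3.2, (3.8)–(3.9) p. 351; Thm 3.5 (the operators `r`).
* [Weil1964] A. Weil, Acta Math. 111 (1964), n° 13 p. 160 (the operators `t₀(f)`, `d₀(α)`, `d₀'(γ)`).
-/

set_option autoImplicit false

noncomputable section

namespace Literature.RepresentationTheory.HeisenbergGroup

open _root_.MeasureTheory Matrix Set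
open scoped NNReal
open Literature.NumberTheory.Automorphic
open Literature.NumberTheory.GaloisRepresentations.IsNonarchimedeanLocalField

variable {F : Type*} [Field F] [ValuativeRel F] [TopologicalSpace F] [IsNonarchimedeanLocalField F]
  {ι : Type*} [Fintype ι] [Invertible (2 : F)]
  {ψ : AddChar F Circle} (hl : IsLocallyConstant (⇑ψ : F → Circle))
  [MeasurableSpace F] [BorelSpace F] (μ : Measure F) [μ.IsAddHaarMeasure] {m : ℤ}
  (hψ : ψ.IsContinuousNontrivial) (hm : ψ.HasConductorExp m)
  {G : Type*} [Group G] (ω : Representation ℂ G (SchwartzBruhat (ι → F)))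

/-- **Evaluation of a big-cell word on the test vector `𝟙_{(𝔭ⁿ)^ι}` at `0`**: if `½⟨x, δ x⟩ ∈ 𝔭^m` on the box
`(𝔭ⁿ)^ι`, then `(r(n(γ)) r(m(B)) r(w) r(n(δ)) 𝟙_{(𝔭ⁿ)^ι})(0) = |det B|^{-1/2} · μ^ι((𝔭ⁿ)^ι)` (the two unipotent phases are
`1`: at `u = 0` trivially, on the box by the conductor; the Fourier transform at `0` is the integral).
[cite: Rangarao1993, Lemma 3.2, (3.8)–(3.9) p. 351] -/
theorem word_piBallSB_apply_zero (γ δ : (ι → F) →ₗ[F] (ι → F)) (B : (ι → F) ≃ₗ[F] (ι → F)) (n : ℤ)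
    (hδ : ∀ x ∈ piPrimePowBall F ι n, halfForm δ x ∈ primePowBall F m) :
    (((unipOpPi hl γ * leviOpPi B * fourierOpPi μ hψ hm * unipOpPi hl δ :
        SchwartzBruhat (ι → F) ≃ₗ[ℂ] SchwartzBruhat (ι → F)) (piBallSB F ι n) :
        SchwartzBruhat (ι → F)) : (ι → F) → ℂ) 0 =
      ((modSqrt B : ℂ))⁻¹ * (((Measure.pi fun _ : ι => μ).real (piPrimePowBall F ι n) : ℝ) : ℂ) := by
  haveI : SecondCountableTopology F := secondCountableTopology_localField F
  rw [LinearEquiv.mul_apply, LinearEquiv.mul_apply, LinearEquiv.mul_apply, coe_unipOpPi_apply, coe_leviOpPi_apply,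
    map_zero, coe_fourierOpPi, piFourierSB_apply]
  have h0 : halfForm γ (0 : ι → F) = 0 := by
    simp [halfForm_apply]
  rw [h0, neg_zero, AddChar.map_zero_eq_one, Circle.coe_one, one_mul]
  congr 1
  -- the integrand is the indicator of the box (phases are `1` there)
  have hint : (fun x : ι → F => ((ψ (x ⬝ᵥ (0 : ι → F)) : Circle) : ℂ) *
      ((unipOpPi hl δ (piBallSB F ι n) : SchwartzBruhat (ι → F)) : (ι → F) → ℂ) x) =
      (piPrimePowBall F ι n).indicator fun _ => (1 : ℂ) := by
    funext x
    rw [dotProduct_zero, AddChar.map_zero_eq_one, Circle.coe_one, one_mul, coe_unipOpPi_apply, coe_piBallSB]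
    by_cases hx : x ∈ piPrimePowBall F ι n
    · rw [indicator_of_mem hx, mul_one, hm.1 _ (neg_mem_primePowBall (hδ x hx)), Circle.coe_one]
    · rw [indicator_of_notMem hx, mul_zero]
  rw [hint, integral_indicator (measurableSet_piPrimePowBall n), setIntegral_const, Complex.real_smul, mul_one]

/-- **Scalar constancy of a big-cell family up to `|det B_k|^{1/2}`**: for a family of big-cell words
`ω(z₀ k) = c(k) · r(n(γ_k)) r(m(B_k)) r(w) r(n(δ_k))` along `z₀ K` (`ω` any representation of any group `G` on `𝒮(F^ι)`),
if `𝟙_{(𝔭ⁿ)^ι}` is `ω(K)`-fixed and `½⟨x, δ_k x⟩ ∈ 𝔭^m` on `(𝔭ⁿ)^ι` for all `k ∈ K`, then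
`c(k) |det B_k|^{-1/2} = c(1) |det B_1|^{-1/2}` for every `k ∈ K` (evaluate at the test vector and at `0`:
`ω(z₀ k) 𝟙 = ω(z₀) 𝟙`). [cite: Rangarao1993, Lemma 3.2, (3.8)–(3.9) p. 351] -/
theorem wordScalar_mul_inv_modSqrt_eq (K : Subgroup G) (z₀ : G) (γ_ δ_ : G → ((ι → F) →ₗ[F] (ι → F)))
    (B_ : G → ((ι → F) ≃ₗ[F] (ι → F))) (c : G → ℂ) (n : ℤ)
    (hword : ∀ k ∈ K, ∀ f : SchwartzBruhat (ι → F),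
      ω (z₀ * k) f = c k •
        ((unipOpPi hl (γ_ k) * leviOpPi (B_ k) * fourierOpPi μ hψ hm * unipOpPi hl (δ_ k) :
          SchwartzBruhat (ι → F) ≃ₗ[ℂ] SchwartzBruhat (ι → F)) f))
    (hfix : ∀ k ∈ K, ω k (piBallSB F ι n) = piBallSB F ι n)
    (hδ : ∀ k ∈ K, ∀ x ∈ piPrimePowBall F ι n, halfForm (δ_ k) x ∈ primePowBall F m) :
    ∀ k ∈ K, c k * ((modSqrt (B_ k) : ℂ))⁻¹ = c 1 * ((modSqrt (B_ 1) : ℂ))⁻¹ := by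
  haveI : SecondCountableTopology F := secondCountableTopology_localField F
  intro k hk
  -- the measure of the box is non-zero
  have hV : ((((Measure.pi fun _ : ι => μ).real (piPrimePowBall F ι n) : ℝ) : ℂ)) ≠ 0 :=
    Complex.ofReal_ne_zero.2 (measureReal_piPrimePowBall_pos (Measure.pi fun _ : ι => μ) n).ne'
  -- evaluate the word identity on the test vector at `0`, for `k` and for `1`
  have hev : ∀ k' ∈ K, (((ω (z₀ * k') (piBallSB F ι n) : SchwartzBruhat (ι → F)) : (ι → F) → ℂ)) 0 =
      c k' * (((modSqrt (B_ k') : ℂ))⁻¹ * (((Measure.pi fun _ : ι => μ).real (piPrimePowBall F ι n) : ℝ) : ℂ)) := by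
    intro k' hk'
    rw [hword k' hk', Submodule.coe_smul, Pi.smul_apply, smul_eq_mul,
      word_piBallSB_apply_zero hl μ hψ hm (γ_ k') (δ_ k') (B_ k') n (hδ k' hk')]
  -- `ω(z₀ k) 𝟙 = ω(z₀) 𝟙 = ω(z₀ 1) 𝟙`
  have hk1 : ω (z₀ * k) (piBallSB F ι n) = ω (z₀ * 1) (piBallSB F ι n) := by
    rw [mul_one, map_mul, Module.End.mul_apply, hfix k hk]
  have h := hev k hk
  rw [hk1, hev 1 K.one_mem] at h
  -- cancel the (non-zero) measure of the box
  rw [← mul_assoc, ← mul_assoc] at h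
  exact (mul_right_cancel₀ hV h).symm

/-- **The big-cell family with ONE constant**: under the hypotheses of `wordScalar_mul_inv_modSqrt_eq` there is `c₀ ∈ ℂ`
with `ω(z₀ k) f = (c₀ · |det B_k|^{1/2}) · r(n(γ_k)) r(m(B_k)) r(w) r(n(δ_k)) f` for all `k ∈ K` and all `f` — the
prefactor of the kernel `c₀ |det B_k|^{1/2} · |det B_k|^{-1/2} = c₀` is independent of `k`.
[cite: Rangarao1993, Lemma 3.2, (3.8)–(3.9) p. 351] -/
theorem exists_const_word (K : Subgroup G) (z₀ : G) (γ_ δ_ : G → ((ι → F) →ₗ[F] (ι → F)))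
    (B_ : G → ((ι → F) ≃ₗ[F] (ι → F))) (c : G → ℂ) (n : ℤ)
    (hword : ∀ k ∈ K, ∀ f : SchwartzBruhat (ι → F),
      ω (z₀ * k) f = c k •
        ((unipOpPi hl (γ_ k) * leviOpPi (B_ k) * fourierOpPi μ hψ hm * unipOpPi hl (δ_ k) :
          SchwartzBruhat (ι → F) ≃ₗ[ℂ] SchwartzBruhat (ι → F)) f))
    (hfix : ∀ k ∈ K, ω k (piBallSB F ι n) = piBallSB F ι n)
    (hδ : ∀ k ∈ K, ∀ x ∈ piPrimePowBall F ι n, halfForm (δ_ k) x ∈ primePowBall F m) :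
    ∃ c₀ : ℂ, ∀ k ∈ K, ∀ f : SchwartzBruhat (ι → F),
      ω (z₀ * k) f = (c₀ * (modSqrt (B_ k) : ℂ)) •
        ((unipOpPi hl (γ_ k) * leviOpPi (B_ k) * fourierOpPi μ hψ hm * unipOpPi hl (δ_ k) :
          SchwartzBruhat (ι → F) ≃ₗ[ℂ] SchwartzBruhat (ι → F)) f) := by
  refine ⟨c 1 * ((modSqrt (B_ 1) : ℂ))⁻¹, fun k hk f => ?_⟩
  have hB : (modSqrt (B_ k) : ℂ) ≠ 0 := Complex.ofReal_ne_zero.2 (modSqrt_pos (B_ k)).ne'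
  rw [hword k hk f, ← wordScalar_mul_inv_modSqrt_eq hl μ hψ hm ω K z₀ γ_ δ_ B_ c n hword hfix hδ k hk,
    inv_mul_cancel_right₀ hB]

/-- **The big-cell family with one NON-ZERO constant**: if moreover the scalar at `k = 1` is non-zero (`ω(z₀) = c(1) · word`
with `ω(z₀)` invertible), the constant `c₀ = c(1) |det B_1|^{-1/2}` of `exists_const_word` is non-zero — the shape of the
hypothesis (W1) together with `cc ≠ 0` of the finite-level trace package. [cite: Rangarao1993, Lemma 3.2, (3.8)–(3.9) p. 351] -/
theorem exists_ne_zero_const_word (K : Subgroup G) (z₀ : G) (γ_ δ_ : G → ((ι → F) →ₗ[F] (ι → F)))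
    (B_ : G → ((ι → F) ≃ₗ[F] (ι → F))) (c : G → ℂ) (n : ℤ)
    (hword : ∀ k ∈ K, ∀ f : SchwartzBruhat (ι → F),
      ω (z₀ * k) f = c k •
        ((unipOpPi hl (γ_ k) * leviOpPi (B_ k) * fourierOpPi μ hψ hm * unipOpPi hl (δ_ k) :
          SchwartzBruhat (ι → F) ≃ₗ[ℂ] SchwartzBruhat (ι → F)) f))
    (hfix : ∀ k ∈ K, ω k (piBallSB F ι n) = piBallSB F ι n)
    (hδ : ∀ k ∈ K, ∀ x ∈ piPrimePowBall F ι n, halfForm (δ_ k) x ∈ primePowBall F m) (hc1 : c 1 ≠ 0) :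
    ∃ c₀ : ℂ, c₀ ≠ 0 ∧ ∀ k ∈ K, ∀ f : SchwartzBruhat (ι → F),
      ω (z₀ * k) f = (c₀ * (modSqrt (B_ k) : ℂ)) •
        ((unipOpPi hl (γ_ k) * leviOpPi (B_ k) * fourierOpPi μ hψ hm * unipOpPi hl (δ_ k) :
          SchwartzBruhat (ι → F) ≃ₗ[ℂ] SchwartzBruhat (ι → F)) f) := by
  have hB1 : (modSqrt (B_ 1) : ℂ) ≠ 0 := Complex.ofReal_ne_zero.2 (modSqrt_pos (B_ 1)).ne'
  refine ⟨c 1 * ((modSqrt (B_ 1) : ℂ))⁻¹, mul_ne_zero hc1 (inv_ne_zero hB1), fun k hk f => ?_⟩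
  have hB : (modSqrt (B_ k) : ℂ) ≠ 0 := Complex.ofReal_ne_zero.2 (modSqrt_pos (B_ k)).ne'
  rw [hword k hk f, ← wordScalar_mul_inv_modSqrt_eq hl μ hψ hm ω K z₀ γ_ δ_ B_ c n hword hfix hδ k hk,
    inv_mul_cancel_right₀ hB]


/-! ## §2 Deep boxes kill the phase of a scalar unipotent: the hypothesis `hδ` for `δ = g · id` -/

omit [MeasurableSpace F] [BorelSpace F] in
/-- `‖⅟2‖ = ‖2‖⁻¹`: if `‖2‖ = q^{-v₂}` then `⅟2 ∈ 𝔭^{-v₂}`. [cite: Weil1964, n° 27, p. 175] -/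
theorem invOf_two_mem_primePowBall {v₂ : ℤ} (h2 : normAbs F (2 : F) = (residueFieldCard F : ℝ≥0)⁻¹ ^ v₂) :
    (⅟(2 : F) : F) ∈ primePowBall F (-v₂) := by
  rw [mem_primePowBall_iff]
  have h : normAbs F (⅟(2 : F)) * normAbs F (2 : F) = 1 := by
    rw [← map_mul, invOf_mul_self, map_one]
  have hq : ((residueFieldCard F : ℝ≥0)⁻¹ ^ v₂) ≠ 0 := (zpow_pos inv_residueFieldCard_pos _).ne'
  have e : normAbs F (⅟(2 : F)) = ((residueFieldCard F : ℝ≥0)⁻¹ ^ v₂)⁻¹ :=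
    eq_inv_of_mul_eq_one_left (by rwa [h2] at h)
  rw [e, ← _root_.zpow_neg]

omit [MeasurableSpace F] [BorelSpace F] in
/-- **the phase `½⟨x, g x⟩` of the scalar unipotent `n(g · 1)` lies in the conductor on a deep box**: for `g ∈ 𝔭^r`,
`‖2‖ = q^{-v₂}` and `x ∈ (𝔭ⁿ)^ι` with `m ≤ r + 2n - v₂`, `½⟨x, g x⟩ ∈ 𝔭^m` — the hypothesis `hδ` of
`wordScalar_mul_inv_modSqrt_eq` for `δ_k = g_k · 1` with `‖g_k‖ ≤ q^{-r}` uniformly in `k`.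
[cite: Rangarao1993, Lemma 3.2, (3.8) p. 351] -/
theorem halfForm_smul_id_mem_primePowBall {g : F} {r : ℤ} (hg : g ∈ primePowBall F r) {v₂ : ℤ}
    (h2 : normAbs F (2 : F) = (residueFieldCard F : ℝ≥0)⁻¹ ^ v₂) {n m' : ℤ} (hm : m' ≤ r + 2 * n - v₂)
    {x : ι → F} (hx : x ∈ piPrimePowBall F ι n) :
    halfForm (g • (LinearMap.id : (ι → F) →ₗ[F] (ι → F))) x ∈ primePowBall F m' := by
  rw [halfForm_apply]
  simp only [LinearMap.smul_apply, LinearMap.id_apply, dotProduct_smul, smul_eq_mul]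
  have h := mul_mem_primePowBall (invOf_two_mem_primePowBall h2)
    (mul_mem_primePowBall hg (dotProduct_mem_primePowBall hx hx))
  exact primePowBall_antitone (by omega) h


end Literature.RepresentationTheory.HeisenbergGroup

end
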